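import Summits.ResolutionOfSingularities.ResolutionOfSingularities.Theorems.PurelyInseparableDim4ResConeLightTripleMinor
import Summits.ResolutionOfSingularities.ResolutionOfSingularities.Theorems.PurelyInseparableDim4ResConeCornerTransport
import HarnessLib
import HarnessLib.Audit.Tags

/-!
# Purely inseparable four-folds — TWO-SLOT GAME, LEGALITY READINGS: under a pure corner step of a straight
# framed state the child keeps shade `3` and `e_G = 3` only if five frame coefficients vanish
# (cell `res-dim4-pi`, K2(p) lane, slice B brick K24a, part β5)

[OURS · counted 0 · cell `res-dim4-pi` · K2(p) lane (holder res-dim4-p-12 g3, «p-1 takes K24a» 2026-08-29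
01:14Z; statement layer 01:24Z, stub β5); spec = res-dim4-idea-4 g3's LEGAL table (bus 00:38:54Z) · seat
res-dim4-p-1 g3.]  Nothing here proves K2(p)/K2(5), `NoIsolatedTrap p p` or resolution of singularities in
dimension ≥ 4 / characteristic `p`.  AI kernel work, weaker than expert review.

SETTING (`p = 5`, `d = 3`, the two-slot regime of A∞(T) read in a frame): a presented state `s̃ = (F̃, r, exc)`
with `r = e_κ + e_o + e_ν` (three boundary letters of weight `1`), `x^r ∣ F̃`, `ord₀ F̃ = 6`, FRAMED at the free
letter `f`: STRAIGHT (the residual's degree-`3` part is `a·x_f³`, `a ≠ 0`; read as: `coeff_{r+3e_f} F̃ ≠ 0` and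
`coeff_{r + 2e_f + e_i} F̃ = 0`) and TSCHIRNHAUS to order `≥ 2` at `x_κ²` (`coeff_{r + 2e_f + 2e_κ} F̃ = 0`).  The
PURE CORNER child in chart `κ` is `CentreBlowup.step 5 univ κ 0 s̃`.

* (tool) under a pure corner step every coefficient is carried by the chart law to the image exponent unless the
  image is a `5`-th power (p-5's `ResCone.coeff_step_zero_chartExponent` and p-7's
  `not_isPthPowerExponent_of_not_dvd`, imported), which the weight-`1` idle letter `ν` forbids here.
* §1 `linearForm_off_eq_zero` — a power cone `c·L³` with `x_f³` present and no `x_f²x_i` is `c ℓ_f³·x_f³`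
  (`3 ≠ 0` in `K`).
* §2 **`legal_readings_of_corner`** — if the child has `ord₀ = 6` and `e_G = 3`, then in the TRANSPORTED frame the
  child is again straight: its residual cone is `a′·x_f³` — every other degree-`3` residual coefficient of the
  child vanishes; and, pulling five of those vanishings back through the chart law:
  `coeff_{r+2e_κ+2e_o} = coeff_{r+2e_κ+e_o+e_ν} = coeff_{r+4e_κ+e_o} = coeff_{r+e_f+2e_κ+e_o} = 0` and (below the
  order) `coeff_{r+3e_κ+e_o} = 0` — idea-4's LEGAL(κ): `S₀ ∌ x_κx_o, x_κx_ν, x_κ³, x_κ²` and `S₁ ∌ x_κ` in the pair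
  presentation `A₀ = x_κx_o S₀`, `A₁ = x_κx_o S₁` (α's `hlegL`/`hlegM` after β3).

[cite: CossartJannsenSaito2020, Thm. 3.14] [cite: HauserPerlega2019PRIMS, §2 (the blowup in the x₁-chart)]
bears_on: LADDER-RESOLUTION:D157-DOOR2 (res-dim4-pi · K2(p) · slice B · K24a-β5).  Supports
stmt-ResolutionOfSingularities-16155 (helper).
-/

set_option linter.dupNamespace false -- mandated namespace of this single-conjunct summit

noncomputable section

namespace Summit.ResolutionOfSingularities.ResolutionOfSingularities.Theorems.PIDim4

namespace ResCone

open MvPolynomial Finset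
open Literature.AlgebraicGeometry.Resolution
open Literature.AlgebraicGeometry.Resolution.CentreBlowup
open Literature.AlgebraicGeometry.Resolution.Hauser2010
open Literature.AlgebraicGeometry.Resolution.HauserPerlega2019

variable {K : Type} [Field K]

/-! ## 1. A straight power cone (the chart law of §1 of the plan is p-5's `…ResConeCornerTransport`) -/

/-- **A power cone `c·L³` that contains `x_f³` and no `x_f²·x_i` is a pure cube of `x_f`**: `ℓ_i = 0` for
`i ≠ f` (`coeff_{x_f³} = c ℓ_f³ ≠ 0`, `coeff_{x_f²x_i} = 3 c ℓ_f² ℓ_i`; needs `3 ≠ 0` in `K`). [folklore] -/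
theorem linearForm_off_eq_zero {ℓ : Fin 4 → K} {c : K} (f : Fin 4) (h3 : (3 : K) ≠ 0)
    (hc : coeff (Finsupp.single f 3) (C c * (∑ i, C (ℓ i) * X i) ^ 3) ≠ 0)
    (h0 : ∀ i, i ≠ f → coeff (Finsupp.single i 1 + Finsupp.single f 2) (C c * (∑ i, C (ℓ i) * X i) ^ 3) = 0) :
    ∀ i, i ≠ f → ℓ i = 0 := by
  intro i hi
  rw [coeff_C_mul, coeff_single_linearFormSum_pow] at hc
  have h := h0 i hi
  have key : coeff (Finsupp.single i 1 + Finsupp.single f 2) ((∑ i, C (ℓ i) * X i : MvPolynomial (Fin 4) K) ^ 3)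
      = (2 + 1 : K) * ℓ f ^ 2 * ℓ i := coeff_single_add_single_linearFormSum_pow hi ℓ 2
  rw [coeff_C_mul, key] at h
  have hcℓ : c ≠ 0 ∧ ℓ f ≠ 0 := by
    refine ⟨fun h0c => hc (by rw [h0c, zero_mul]), fun h0ℓ => hc (by rw [h0ℓ]; ring)⟩
  have h3' : (2 + 1 : K) ≠ 0 := by rw [show (2 + 1 : K) = 3 by norm_num]; exact h3
  rcases mul_eq_zero.mp h with h1 | h1
  · exact absurd h1 hcℓ.1
  · rcases mul_eq_zero.mp h1 with h2 | h2
    · rcases mul_eq_zero.mp h2 with h4 | h4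
      · exact absurd h4 h3'
      · exact absurd (pow_eq_zero_iff (by norm_num) |>.mp h4) hcℓ.2
    · exact h2

/-- **All degree-`3` coefficients of a straight power cone other than `x_f³` vanish.** [folklore] -/
theorem coeff_powerCone_eq_zero_of_straight {ℓ : Fin 4 → K} {c : K} (f : Fin 4) (h3 : (3 : K) ≠ 0)
    (hc : coeff (Finsupp.single f 3) (C c * (∑ i, C (ℓ i) * X i) ^ 3) ≠ 0)
    (h0 : ∀ i, i ≠ f → coeff (Finsupp.single i 1 + Finsupp.single f 2) (C c * (∑ i, C (ℓ i) * X i) ^ 3) = 0)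
    {m : Fin 4 →₀ ℕ} (hm : m ≠ Finsupp.single f 3) :
    coeff m (C c * (∑ i, C (ℓ i) * X i) ^ 3) = 0 := by
  classical
  have hoff := linearForm_off_eq_zero f h3 hc h0
  have hL : (∑ i, C (ℓ i) * X i : MvPolynomial (Fin 4) K) = C (ℓ f) * X f := by
    rw [← Finset.add_sum_erase _ _ (Finset.mem_univ f)]
    rw [Finset.sum_eq_zero fun i hi => by rw [hoff i (Finset.ne_of_mem_erase hi), C_0, zero_mul], add_zero]
  rw [hL, mul_pow, ← map_pow, ← mul_assoc, ← map_mul, X_pow_eq_monomial, C_mul_monomial, coeff_monomial,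
    if_neg (Ne.symm hm)]

/-! ## 2. Legality of a pure corner step, read in the frame -/

/-- Four pairwise distinct letters exhaust `Fin 4`. [folklore] -/
theorem letters_exhaust {κ o ν f : Fin 4} (hκo : κ ≠ o) (hκν : κ ≠ ν) (hκf : κ ≠ f) (hoν : o ≠ ν)
    (hof : o ≠ f) (hνf : ν ≠ f) (k : Fin 4) : k = κ ∨ k = o ∨ k = ν ∨ k = f := by
  have hcard : ({κ, o, ν, f} : Finset (Fin 4)).card = 4 := by
    rw [Finset.card_insert_of_notMem (by simp [hκo, hκν, hκf]),
      Finset.card_insert_of_notMem (by simp [hoν, hof]), Finset.card_insert_of_notMem (by simp [hνf]),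
      Finset.card_singleton]
  have huniv : ({κ, o, ν, f} : Finset (Fin 4)) = Finset.univ :=
    Finset.eq_univ_of_card _ (by rw [hcard, Fintype.card_fin])
  have hk : k ∈ ({κ, o, ν, f} : Finset (Fin 4)) := huniv ▸ Finset.mem_univ k
  simpa [Finset.mem_insert, Finset.mem_singleton] using hk

section Legal

variable [CharP K 5] [DecidableEq K]

omit [CharP K 5] in
/-- Under the pure corner step in chart `κ` of a state whose boundary has weight `1` at `κ` and `ord₀ = 6`, the
boundary does not change: `r′ = r`. [cite: HauserPerlega2019PRIMS, §2 (transform D' of D)] [folklore] -/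
theorem step_zero_r_eq {κ : Fin 4} {s : State K} (ho : ordZero s.F = (6 : ℕ))
    (hdiv : ∀ e ∈ s.F.support, s.r ≤ e) (hrκ : s.r κ = 1) :
    (CentreBlowup.step 5 Finset.univ κ 0 s).r = s.r := by
  rw [step_zero_r 5 κ s ho hdiv]
  ext i
  by_cases hi : i = κ
  · rw [hi, Finsupp.coe_update, Function.update_self, hrκ]
  · rw [Finsupp.coe_update, Function.update_of_ne hi]

/-- **The chart image of a frame monomial**: with boundary `r = e_κ + e_o + e_ν`, for `|m| ≥ 3`,
`chartExponent 5 univ κ (r + m) = r + m.update κ (|m| − 3)`. [folklore] -/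
theorem chartExponent_boundary_add {κ o ν : Fin 4} (hκo : κ ≠ o) (hκν : κ ≠ ν) {r m : Fin 4 →₀ ℕ}
    (hr : r = Finsupp.single κ 1 + Finsupp.single o 1 + Finsupp.single ν 1) (hm : 3 ≤ m.degree) :
    chartExponent 5 Finset.univ κ (r + m) = r + m.update κ (m.degree - 3) := by
  have hrκ : r κ = 1 := by rw [hr]; simp [hκo.symm, hκν.symm]
  have hrdeg : r.degree = 3 := by rw [hr, map_add, map_add]; simp
  rw [chartExponent_univ_eq_update]
  ext k
  by_cases hk : k = κ
  · rw [hk, Finsupp.coe_update, Function.update_self, Finsupp.add_apply, Finsupp.coe_update,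
      Function.update_self, map_add, hrdeg, hrκ]
    omega
  · rw [Finsupp.coe_update, Function.update_of_ne hk, Finsupp.add_apply, Finsupp.add_apply,
      Finsupp.coe_update, Function.update_of_ne hk]

/-- **THE TRANSPORTED FRAME STRAIGHTENS THE CHILD, and LEGALITY** (K24a-β5).  Pure corner step in chart `κ`
(`p = 5`) of a framed state with boundary `r = e_κ + e_o + e_ν` (weights `1`), `x^r ∣ F̃`, `ord₀ F̃ = 6`, free
letter `f`, STRAIGHT (`coeff_{r+3e_f} F̃ ≠ 0`, `coeff_{r+2e_f+e_i} F̃ = 0` for `i ≠ f`) and Tschirnhaus at `x_κ²`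
(`coeff_{r+2e_f+2e_κ} F̃ = 0`); if the child has `ord₀ = 6` and `e_G = 3` then: the child's residual cone is
`a·x_f³` in the transported frame — every degree-`3` residual coefficient other than `x_f³` vanishes — and the
parent's coefficients at `r+2e_κ+2e_o`, `r+3e_κ+e_o`, `r+2e_κ+e_o+e_ν`, `r+4e_κ+e_o`, `r+e_f+2e_κ+e_o` vanish.
[OURS · idea-4's LEGAL(κ) table] [cite: CossartJannsenSaito2020, Thm. 3.14] -/
theorem legal_readings_of_corner {κ o ν f : Fin 4} (hκo : κ ≠ o) (hκν : κ ≠ ν)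
    (hκf : κ ≠ f) (hoν : o ≠ ν) (hof : o ≠ f) (hνf : ν ≠ f) {s : State K}
    (hr : s.r = Finsupp.single κ 1 + Finsupp.single o 1 + Finsupp.single ν 1)
    (hdiv : ∀ e ∈ s.F.support, s.r ≤ e) (ho : ordZero s.F = (6 : ℕ))
    (ha : coeff (s.r + Finsupp.single f 3) s.F ≠ 0)
    (hstraight : ∀ i, i ≠ f → coeff (s.r + (Finsupp.single f 2 + Finsupp.single i 1)) s.F = 0)
    (htsch : coeff (s.r + (Finsupp.single f 2 + Finsupp.single κ 2)) s.F = 0)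
    (ho' : ordZero (CentreBlowup.step 5 Finset.univ κ 0 s).F = (6 : ℕ))
    (he3' : Module.finrank K (resVertex (CentreBlowup.step 5 Finset.univ κ 0 s)) = 3) :
    (∀ m : Fin 4 →₀ ℕ, m.degree = 3 → m ≠ Finsupp.single f 3 →
        coeff (s.r + m) (CentreBlowup.step 5 Finset.univ κ 0 s).F = 0) ∧
      coeff (s.r + Finsupp.single f 3) (CentreBlowup.step 5 Finset.univ κ 0 s).F =
        coeff (s.r + Finsupp.single f 3) s.F ∧
      coeff (s.r + (Finsupp.single κ 2 + Finsupp.single o 2)) s.F = 0 ∧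
      coeff (s.r + (Finsupp.single κ 3 + Finsupp.single o 1)) s.F = 0 ∧
      coeff (s.r + (Finsupp.single κ 2 + Finsupp.single o 1 + Finsupp.single ν 1)) s.F = 0 ∧
      coeff (s.r + (Finsupp.single κ 4 + Finsupp.single o 1)) s.F = 0 ∧
      coeff (s.r + (Finsupp.single f 1 + Finsupp.single κ 2 + Finsupp.single o 1)) s.F = 0 := by
  haveI : Fact (Nat.Prime 5) := ⟨by norm_num⟩
  have h3 : (3 : K) ≠ 0 := fun h =>
    absurd ((CharP.cast_eq_zero_iff K 5 3).mp (by exact_mod_cast h)) (by norm_num)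
  set s' := CentreBlowup.step 5 Finset.univ κ 0 s with hs'
  have hrκ : s.r κ = 1 := by rw [hr]; simp [hκo.symm, hκν.symm]
  have hrν : s.r ν = 1 := by rw [hr]; simp [hκν, hoν]
  have hr' : s'.r = s.r := step_zero_r_eq ho hdiv hrκ
  have hrdeg : s.r.degree = 3 := by rw [hr, map_add, map_add]; simp
  have hdiv' : ∀ e ∈ s'.F.support, s'.r ≤ e :=
    newMult_le_of_mem_support_step 5 Finset.univ κ 0 rfl s ho hdiv (perm_univ ho hdiv)
  have hq : ((5 : ℕ) : ℕ∞) ≤ ordAlong Finset.univ s.F := by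
    rw [ordAlong_univ, ho]; exact_mod_cast (by norm_num : 5 ≤ 6)
  -- the chart law at frame monomials `r + m`, `|m| ≥ 3`, `m ν ≤ 1` (so the image is no 5-th power)
  have hchart : ∀ m : Fin 4 →₀ ℕ, 3 ≤ m.degree → m ν ≤ 1 →
      coeff (s.r + m.update κ (m.degree - 3)) s'.F = coeff (s.r + m) s.F := by
    intro m hm hmν
    rw [← chartExponent_boundary_add hκo hκν hr hm, coeff_step_zero_chartExponent 5 κ s hq
      (by rw [map_add, hrdeg]; omega), if_neg (not_isPthPowerExponent_of_not_dvd (i := ν) ?_)]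
    rw [chartExponent_boundary_add hκo hκν hr hm, Finsupp.add_apply, hrν, Finsupp.coe_update,
      Function.update_of_ne hκν.symm]
    omega
  -- the child's residual cone and how to read the child at degree 6
  obtain ⟨ℓ', c, -, -, hform⟩ := resForm_eq_C_mul_pow_of_finrank_eq_three 5 ho'
    (by rw [hr', hrdeg]; norm_num) he3'
  rw [hr', hrdeg, show 6 - 3 = 3 from rfl] at hform
  have hread : ∀ m : Fin 4 →₀ ℕ, m.degree = 3 →
      coeff (s.r + m) s'.F = coeff m (C c * (∑ i, C (ℓ' i) * X i) ^ 3) := by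
    intro m hm
    have h := congrArg (coeff (s.r + m)) (monomial_mul_resForm hdiv')
    rw [hr', coeff_monomial_mul', if_pos le_self_add, one_mul, add_tsub_cancel_left, hform] at h
    rw [h]
    unfold initialForm
    rw [ho', ENat.toNat_coe, coeff_homogeneousComponent, if_pos (by rw [map_add, hrdeg, hm])]
  -- (i) the child is straight: no `x_f² x_i`
  have hchild_straight : ∀ i, i ≠ f →
      coeff (Finsupp.single i 1 + Finsupp.single f 2) (C c * (∑ i, C (ℓ' i) * X i) ^ 3) = 0 := by
    intro i hi
    have hdeg3 : (Finsupp.single i 1 + Finsupp.single f 2 : Fin 4 →₀ ℕ).degree = 3 := by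
      rw [map_add, Finsupp.degree_single, Finsupp.degree_single]
    rw [← hread _ hdeg3]
    by_cases hiκ : i = κ
    · -- preimage: the Tschirnhaus monomial `r + 2e_f + 2e_κ`
      subst hiκ
      have h := hchart (Finsupp.single f 2 + Finsupp.single i 2) (by
        rw [map_add, Finsupp.degree_single, Finsupp.degree_single]; norm_num) (by
        simp [hνf.symm, hκν])
      have hupd : (Finsupp.single f 2 + Finsupp.single i 2 : Fin 4 →₀ ℕ).update i
          ((Finsupp.single f 2 + Finsupp.single i 2 : Fin 4 →₀ ℕ).degree - 3) =
          Finsupp.single i 1 + Finsupp.single f 2 := by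
        rw [map_add, Finsupp.degree_single, Finsupp.degree_single]
        ext k; by_cases hk : k = i
        · subst hk; simp [hκf.symm]
        · simp [Finsupp.coe_update, Function.update_of_ne hk, Finsupp.single_apply, Ne.symm hk]
      rw [hupd] at h
      rw [h]; exact htsch
    · -- preimage: `r + 2e_f + e_i` itself (its `κ`-exponent is `1`)
      have h := hchart (Finsupp.single f 2 + Finsupp.single i 1) (by
        rw [map_add, Finsupp.degree_single, Finsupp.degree_single]) (by
        simp only [Finsupp.add_apply, Finsupp.single_apply, if_neg hνf.symm, zero_add]
        split_ifs <;> omega)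
      have hupd : (Finsupp.single f 2 + Finsupp.single i 1 : Fin 4 →₀ ℕ).update κ
          ((Finsupp.single f 2 + Finsupp.single i 1 : Fin 4 →₀ ℕ).degree - 3) =
          Finsupp.single i 1 + Finsupp.single f 2 := by
        rw [map_add, Finsupp.degree_single, Finsupp.degree_single]
        ext k; by_cases hk : k = κ
        · subst hk; simp [hκf, Ne.symm hiκ]
        · simp [Finsupp.coe_update, Function.update_of_ne hk, Finsupp.single_apply]
          ring
      rw [hupd] at h
      rw [h]; exact hstraight i hi
  -- the `x_f³` coefficient is carried (`r + 3e_f` is fixed by the chart law)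
  have hx3 : coeff (s.r + Finsupp.single f 3) s'.F = coeff (s.r + Finsupp.single f 3) s.F := by
    have h := hchart (Finsupp.single f 3) (by rw [Finsupp.degree_single]) (by
      simp [hνf.symm])
    have hupd : (Finsupp.single f 3 : Fin 4 →₀ ℕ).update κ ((Finsupp.single f 3 : Fin 4 →₀ ℕ).degree - 3) =
        Finsupp.single f 3 := by
      rw [Finsupp.degree_single, Nat.sub_self]
      ext k; by_cases hk : k = κ
      · subst hk; simp [hκf.symm]
      · simp [Finsupp.coe_update, Function.update_of_ne hk]
    rwa [hupd] at h
  have hc3 : coeff (Finsupp.single f 3) (C c * (∑ i, C (ℓ' i) * X i) ^ 3) ≠ 0 := by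
    rw [← hread _ (Finsupp.degree_single f 3), hx3]; exact ha
  -- (ii) every other degree-3 residual coefficient of the child vanishes
  have hzero : ∀ m : Fin 4 →₀ ℕ, m.degree = 3 → m ≠ Finsupp.single f 3 → coeff (s.r + m) s'.F = 0 :=
    fun m hm hne => by rw [hread m hm]; exact coeff_powerCone_eq_zero_of_straight f h3 hc3 hchild_straight hne
  refine ⟨hzero, hx3, ?_, ?_, ?_, ?_, ?_⟩
  · -- `x_κ²x_o² ↦ x_κ x_o²`
    have h := hchart (Finsupp.single κ 2 + Finsupp.single o 2) (by
      rw [map_add, Finsupp.degree_single, Finsupp.degree_single]; norm_num) (by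
      simp [hκν, hoν])
    have hupd : (Finsupp.single κ 2 + Finsupp.single o 2 : Fin 4 →₀ ℕ).update κ
        ((Finsupp.single κ 2 + Finsupp.single o 2 : Fin 4 →₀ ℕ).degree - 3) =
        Finsupp.single κ 1 + Finsupp.single o 2 := by
      rw [map_add, Finsupp.degree_single, Finsupp.degree_single]
      ext k; by_cases hk : k = κ
      · subst hk; simp [hκo]
      · simp [Finsupp.coe_update, Function.update_of_ne hk, Finsupp.single_apply, Ne.symm hk]
    rw [hupd] at h
    rw [← h]
    refine hzero _ (by rw [map_add, Finsupp.degree_single, Finsupp.degree_single]) fun heq => ?_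
    have := DFunLike.congr_fun heq o
    simp [hκo, hof.symm] at this
  · -- `x_κ³x_o ↦ x_κ x_o`: below the order of the child
    have h := hchart (Finsupp.single κ 3 + Finsupp.single o 1) (by
      rw [map_add, Finsupp.degree_single, Finsupp.degree_single]; norm_num) (by
      simp [hκν, hoν])
    rw [← h]
    refine coeff_eq_zero_of_degree_lt_ordZero ?_
    rw [ho', map_add, hrdeg, map_add, Finsupp.degree_single, Finsupp.degree_single]
    have : ((Finsupp.single κ 3 + Finsupp.single o 1 : Fin 4 →₀ ℕ).update κ (3 + 1 - 3)).degree = 2 := by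
      rw [show (3 + 1 - 3 : ℕ) = 1 from rfl]
      have hu : (Finsupp.single κ 3 + Finsupp.single o 1 : Fin 4 →₀ ℕ).update κ 1 =
          Finsupp.single κ 1 + Finsupp.single o 1 := by
        ext k; by_cases hk : k = κ
        · subst hk; simp [hκo]
        · simp [Finsupp.coe_update, Function.update_of_ne hk, Finsupp.single_apply, Ne.symm hk]
      rw [hu, map_add, Finsupp.degree_single, Finsupp.degree_single]
    rw [this]; exact_mod_cast (by norm_num : 3 + 2 < 6)
  · -- `x_κ²x_o x_ν ↦ x_κ x_o x_ν`
    have h := hchart (Finsupp.single κ 2 + Finsupp.single o 1 + Finsupp.single ν 1) (by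
      rw [map_add, map_add, Finsupp.degree_single, Finsupp.degree_single, Finsupp.degree_single]; norm_num) (by
      simp [hκν, hoν])
    have hupd : (Finsupp.single κ 2 + Finsupp.single o 1 + Finsupp.single ν 1 : Fin 4 →₀ ℕ).update κ
        ((Finsupp.single κ 2 + Finsupp.single o 1 + Finsupp.single ν 1 : Fin 4 →₀ ℕ).degree - 3) =
        Finsupp.single κ 1 + Finsupp.single o 1 + Finsupp.single ν 1 := by
      rw [map_add, map_add, Finsupp.degree_single, Finsupp.degree_single, Finsupp.degree_single]
      ext k; by_cases hk : k = κ
      · subst hk; simp [hκo, hκν]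
      · simp [Finsupp.coe_update, Function.update_of_ne hk, Finsupp.single_apply, Ne.symm hk]
    rw [hupd] at h
    rw [← h]
    refine hzero _ (by rw [map_add, map_add, Finsupp.degree_single, Finsupp.degree_single,
      Finsupp.degree_single]) fun heq => ?_
    have := DFunLike.congr_fun heq ν
    simp [hκν, hoν, hνf] at this
  · -- `x_κ⁴x_o ↦ x_κ² x_o`
    have h := hchart (Finsupp.single κ 4 + Finsupp.single o 1) (by
      rw [map_add, Finsupp.degree_single, Finsupp.degree_single]; norm_num) (by
      simp [hκν, hoν])
    have hupd : (Finsupp.single κ 4 + Finsupp.single o 1 : Fin 4 →₀ ℕ).update κ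
        ((Finsupp.single κ 4 + Finsupp.single o 1 : Fin 4 →₀ ℕ).degree - 3) =
        Finsupp.single κ 2 + Finsupp.single o 1 := by
      rw [map_add, Finsupp.degree_single, Finsupp.degree_single]
      ext k; by_cases hk : k = κ
      · subst hk; simp [hκo]
      · simp [Finsupp.coe_update, Function.update_of_ne hk, Finsupp.single_apply, Ne.symm hk]
    rw [hupd] at h
    rw [← h]
    refine hzero _ (by rw [map_add, Finsupp.degree_single, Finsupp.degree_single]) fun heq => ?_
    have := DFunLike.congr_fun heq o
    simp [hκo, hof.symm] at this
  · -- `x_f x_κ² x_o ↦ x_f x_κ x_o`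
    have h := hchart (Finsupp.single f 1 + Finsupp.single κ 2 + Finsupp.single o 1) (by
      rw [map_add, map_add, Finsupp.degree_single, Finsupp.degree_single, Finsupp.degree_single]; norm_num) (by
      simp [hκν, hoν, hνf.symm])
    have hupd : (Finsupp.single f 1 + Finsupp.single κ 2 + Finsupp.single o 1 : Fin 4 →₀ ℕ).update κ
        ((Finsupp.single f 1 + Finsupp.single κ 2 + Finsupp.single o 1 : Fin 4 →₀ ℕ).degree - 3) =
        Finsupp.single f 1 + Finsupp.single κ 1 + Finsupp.single o 1 := by
      rw [map_add, map_add, Finsupp.degree_single, Finsupp.degree_single, Finsupp.degree_single]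
      ext k; by_cases hk : k = κ
      · subst hk; simp [hκo, hκf.symm]
      · simp [Finsupp.coe_update, Function.update_of_ne hk, Finsupp.single_apply, Ne.symm hk]
    rw [hupd] at h
    rw [← h]
    refine hzero _ (by rw [map_add, map_add, Finsupp.degree_single, Finsupp.degree_single,
      Finsupp.degree_single]) fun heq => ?_
    have := DFunLike.congr_fun heq o
    simp [hκo, hof.symm] at this

end Legal

end ResCone

end Summit.ResolutionOfSingularities.ResolutionOfSingularities.Theorems.PIDim4

end
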